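import Summits.Schanuel.Schanuel.Theorems.RootDecomp1KRelLiouvilleCell04

/-!
# RootDecomp1KRelLiouvilleCell — lens 1, generation 34 «RELATIVE-LIOUVILLE CELL of 33364» (RootDecomp1KRelLiouvilleCell.lean fc1db392…, 1985 l) — continuation (RootDecomp1KRelLiouvilleCell05): §5 one variable as a `Fin 1`-tuple (`PolyMeasure t ⇒ MvPolyMeasure ![t]`); §6 the member coordinate `ℓ_T = Σ_j 2^{-(t_j)!}` (`tIdx`, `ellT`, `logHyperLiouville_ellT`)

(lens-1 g34 `RootDecomp1KRelLiouvilleCell.lean`, sha256 fc1db392…9176, own farm rc 0 · 0 sorry · axioms std; critic VERDICT STATUS L1658 PORT GO LOW;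
port by census-1 gen 15 in eight parts `RootDecomp1KRelLiouvilleCell01`–`08` — see the PORT NOTE of part 01; `--supports stmt-Schanuel-33364`; rung 0.)
-/

noncomputable section

open Complex IntermediateField Polynomial
open Summit.Schanuel.Schanuel.Theorems.RootDecomp1KHyper
open Summit.Schanuel.Schanuel.Theorems.RootDecomp1KHyper.HyperCell
open Summit.Schanuel.Schanuel.Theorems.RootDecomp1KGeneric

namespace Summit.Schanuel.Schanuel.Theorems.RootDecomp1KRelLiouvilleCell

/-! ## §5  One variable as a `Fin 1`-tuple: `PolyMeasure t ⇒ MvPolyMeasure ![t]` -/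

section FinOne

/-- A one-variable polynomial measure is a several-variables measure of the `Fin 1`-tuple
(bookkeeping: `P ∈ ℤ[X₀]` ↦ `p = Σ a_k X^k`, `a_k` the constant coefficient of the `k`-th slice;
`len p ≤ (d+1)·mvlen P`, `natDegree p ≤ totalDegree P`). -/
theorem mvPolyMeasure_one_of_polyMeasure {t : ℂ} (ht : PolyMeasure t) :
    MvPolyMeasure (![t] : Fin 1 → ℂ) := by
  classical
  intro d
  obtain ⟨C₀, τ, hC₀, hmeas⟩ := ht d
  refine ⟨C₀ * ((d : ℝ) + 1) ^ τ, τ, by positivity, fun P hP hdeg => ?_⟩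
  set K : ℕ := (MvPolynomial.finSuccEquiv ℤ 0 P).natDegree with hKdef
  have hKd : K ≤ d := (natDegree_finSuccEquiv_le_totalDegree P).trans hdeg
  -- the slices are constants a_k
  set a : ℕ → ℤ := fun k => MvPolynomial.coeff 0 (ycoeff P k) with hadef
  have hyc : ∀ k, ycoeff P k = MvPolynomial.C (a k) := fun k => MvPolynomial.eq_C_of_isEmpty _
  -- the one-variable polynomial p
  set p : ℤ[X] := Polynomial.map (MvPolynomial.constantCoeff : MvPolynomial (Fin 0) ℤ →+* ℤ)
    (MvPolynomial.finSuccEquiv ℤ 0 P) with hpdef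
  have hpcoeff : ∀ k, p.coeff k = a k := fun k => by
    rw [hpdef, Polynomial.coeff_map, MvPolynomial.constantCoeff_eq]; rfl
  have hpK : p.natDegree ≤ K := by rw [hpdef]; exact Polynomial.natDegree_map_le
  have haK : a K ≠ 0 := by
    intro h0
    have hne : MvPolynomial.finSuccEquiv ℤ 0 P ≠ 0 := (EmbeddingLike.map_ne_zero_iff).mpr hP
    have h1 := Polynomial.leadingCoeff_ne_zero.mpr hne
    rw [Polynomial.leadingCoeff] at h1
    have h2 : ycoeff P K = 0 := by rw [hyc, h0, MvPolynomial.C_0]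
    exact h1 h2
  have hp0 : p ≠ 0 := fun h => haK (by rw [← hpcoeff, h, Polynomial.coeff_zero])
  -- the two evaluations agree
  have heval : Polynomial.aeval t p = MvPolynomial.aeval (![t] : Fin 1 → ℂ) P := by
    have e1 : (![t] : Fin 1 → ℂ) = Fin.cons t (![] : Fin 0 → ℂ) := rfl
    rw [e1, mvaeval_cons_eq_sum P _ t le_rfl,
      Polynomial.aeval_eq_sum_range' (Nat.lt_succ_of_le hpK)]
    refine Finset.sum_congr rfl fun k _ => ?_
    rw [hpcoeff, hyc, MvPolynomial.aeval_C, zsmul_eq_mul, algebraMap_int_eq, eq_intCast]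
  -- the lengths
  have hlenZ : len p ≤ ((d + 1 : ℕ) : ℤ) * mvlen P := by
    calc len p ≤ ∑ k ∈ Finset.range (K + 1), |p.coeff k| := len_le_of_natDegree_le p hpK
      _ ≤ ∑ _k ∈ Finset.range (K + 1), mvlen P := by
          refine Finset.sum_le_sum fun k _ => ?_
          rw [hpcoeff, hadef]
          exact (abs_coeff_le_mvlen _ _).trans (mvlen_ycoeff_le P k)
      _ = ((K + 1 : ℕ) : ℤ) * mvlen P := by rw [Finset.sum_const, Finset.card_range, nsmul_eq_mul]
      _ ≤ ((d + 1 : ℕ) : ℤ) * mvlen P :=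
          mul_le_mul_of_nonneg_right (by exact_mod_cast Nat.succ_le_succ hKd) (mvlen_nonneg P)
  have hlen : ((len p : ℤ) : ℝ) ≤ ((d : ℝ) + 1) * ((mvlen P : ℤ) : ℝ) := by
    have h : ((len p : ℤ) : ℝ) ≤ ((((d + 1 : ℕ) : ℤ) * mvlen P : ℤ) : ℝ) := by exact_mod_cast hlenZ
    push_cast at h
    linarith
  have hlen0 : (0 : ℝ) ≤ ((len p : ℤ) : ℝ) := by exact_mod_cast len_nonneg p
  -- assemble
  have h1 := hmeas p hp0 (hpK.trans hKd)
  rw [heval] at h1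
  have e1 : ((len p : ℤ) : ℝ) ^ τ ≤ (((d : ℝ) + 1) * ((mvlen P : ℤ) : ℝ)) ^ τ :=
    pow_le_pow_left₀ hlen0 hlen τ
  calc (1 : ℝ) ≤ C₀ * ((len p : ℤ) : ℝ) ^ τ * ‖MvPolynomial.aeval (![t] : Fin 1 → ℂ) P‖ := h1
    _ ≤ C₀ * (((d : ℝ) + 1) * ((mvlen P : ℤ) : ℝ)) ^ τ * ‖MvPolynomial.aeval (![t] : Fin 1 → ℂ) P‖ :=
        mul_le_mul_of_nonneg_right (mul_le_mul_of_nonneg_left e1 hC₀.le) (norm_nonneg _)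
    _ = C₀ * ((d : ℝ) + 1) ^ τ * ((mvlen P : ℤ) : ℝ) ^ τ *
          ‖MvPolynomial.aeval (![t] : Fin 1 → ℂ) P‖ := by rw [mul_pow]; ring

/-- `(ℓ₂, π)` has a log-power measure — UNCONDITIONAL (π's measure is tree-proved, `polyMeasure_pi`). -/
theorem logPowMeasure_liouvilleNumber_pi :
    LogPowMeasure (Fin.cons ((liouvilleNumber 2 : ℝ) : ℂ) ![(Real.pi : ℂ)] : Fin 2 → ℂ) :=
  logPowMeasure_cons_liouvilleNumber (mvPolyMeasure_one_of_polyMeasure polyMeasure_pi)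

/-- `(ℓ₂, e)` has a log-power measure (mod the Nesterenko–Waldschmidt measure of `e`, `hNW`). -/
theorem logPowMeasure_liouvilleNumber_exp_one (hNW : NWMeasure) :
    LogPowMeasure (Fin.cons ((liouvilleNumber 2 : ℝ) : ℂ) ![cexp 1] : Fin 2 → ℂ) :=
  logPowMeasure_cons_liouvilleNumber (mvPolyMeasure_one_of_polyMeasure (polyMeasure_exp_one_of_NW hNW))

end FinOne

/-! ## §6  The member coordinate `ℓ_T = Σ_j 2^{-(t_j)!}`, `t₀ = 2`, `t_{j+1} = 2^{t_j}`

`ℓ_T` is LOG-HYPER-Liouville (its best rational approximations at denominators `q = 2^{(t_j)!}` have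
error `≈ 2^{-(2^{t_j})!} < exp(-(log q)^m)` for every `m`, eventually), but — sharing the digit
skeleton `{2^{-k!}}` of `ℓ₂` — it is NOT hyper-Liouville, and the pair `(ℓ₂, ℓ_T)` admits no
hyper-small integer linear form (§7). -/

section Member
open LiouvilleNumber
open scoped Nat

/-- The index tower `t₀ = 2`, `t_{j+1} = 2^{t_j}`: `2, 4, 16, 65536, …`. -/
def tIdx : ℕ → ℕ
  | 0 => 2
  | j + 1 => 2 ^ tIdx j

/-- `t₀ = 2`. -/
@[simp] theorem tIdx_zero : tIdx 0 = 2 := rfl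

/-- `t_{j+1} = 2^{t_j}`. -/
theorem tIdx_succ (j : ℕ) : tIdx (j + 1) = 2 ^ tIdx j := rfl

/-- `2 ≤ t_j`. -/
theorem two_le_tIdx (j : ℕ) : 2 ≤ tIdx j := by
  induction j with
  | zero => simp
  | succ j ih =>
    rw [tIdx_succ]
    calc 2 ≤ 2 ^ 2 := by norm_num
      _ ≤ 2 ^ tIdx j := Nat.pow_le_pow_right (by norm_num) ih

/-- `t + 2 ≤ 2^t` for `t ≥ 2`. -/
private theorem add_two_le_two_pow {t : ℕ} (ht : 2 ≤ t) : t + 2 ≤ 2 ^ t := by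
  obtain ⟨s, rfl⟩ : ∃ s, t = s + 1 := ⟨t - 1, by omega⟩
  have hs : s + 1 ≤ 2 ^ s := Nat.lt_two_pow_self
  rw [pow_succ]
  omega

/-- `t_j + 2 ≤ t_{j+1}`. -/
theorem tIdx_add_two_le_succ (j : ℕ) : tIdx j + 2 ≤ tIdx (j + 1) := by
  rw [tIdx_succ]; exact add_two_le_two_pow (two_le_tIdx j)

/-- `t_j < t_{j+1}`. -/
theorem tIdx_lt_succ (j : ℕ) : tIdx j < tIdx (j + 1) := by
  have := tIdx_add_two_le_succ j; omega

/-- The tower indices `t_j` are strictly increasing. -/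
theorem tIdx_strictMono : StrictMono tIdx := strictMono_nat_of_lt_succ tIdx_lt_succ

/-- `j + 2 ≤ t_j`. -/
theorem le_tIdx (j : ℕ) : j + 2 ≤ tIdx j := by
  induction j with
  | zero => simp
  | succ j ih => have := tIdx_add_two_le_succ j; omega

/-- Members of the tower are never consecutive integers. -/
theorem tIdx_ne_tIdx_add_one (i j : ℕ) : tIdx j ≠ tIdx i + 1 := by
  intro h
  have hij : i < j := tIdx_strictMono.lt_iff_lt.mp (by omega)
  have h2 : tIdx (i + 1) ≤ tIdx j := tIdx_strictMono.monotone (by omega)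
  have h3 := tIdx_add_two_le_succ i
  omega

/-- `(t_j)! < (t_{j+1})!`. -/
theorem tfact_lt_succ (j : ℕ) : (tIdx j)! < (tIdx (j + 1))! :=
  (Nat.factorial_lt (by have := two_le_tIdx j; omega)).mpr (tIdx_lt_succ j)

/-- `(t_K)! + k ≤ (t_{K+k})!`. -/
theorem tfact_add_le (K k : ℕ) : (tIdx K)! + k ≤ (tIdx (K + k))! := by
  induction k with
  | zero => simp
  | succ k ih =>
    have := tfact_lt_succ (K + k)
    rw [show K + (k + 1) = K + k + 1 by ring]
    omega

/-- `ℓ_T := Σ_j 2^{-(t_j)!}`. -/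
def ellT : ℝ := ∑' j, 1 / (2 : ℝ) ^ (tIdx j)!

/-- The series `Σ_j 2^{-(t_j)!}` is summable. -/
theorem summable_ellT : Summable fun j => 1 / (2 : ℝ) ^ (tIdx j)! :=
  summable_one_div_pow_of_le (by norm_num) fun j =>
    ((le_tIdx j).trans (Nat.self_le_factorial _)).trans' (by omega)

/-- Partial sums: `Σ_{k ≤ K} 2^{-(t_k)!} = M / 2^{(t_K)!}` with `M` odd. -/
theorem ellT_partialSum (K : ℕ) :
    ∃ M : ℕ, Odd M ∧ ∑ k ∈ Finset.range (K + 1), 1 / (2 : ℝ) ^ (tIdx k)! = M / (2 : ℝ) ^ (tIdx K)! := by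
  induction K with
  | zero => exact ⟨1, odd_one, by simp⟩
  | succ K ih =>
    obtain ⟨M, hM, hs⟩ := ih
    have hlt := tfact_lt_succ K
    refine ⟨M * 2 ^ ((tIdx (K + 1))! - (tIdx K)!) + 1, ?_, ?_⟩
    · refine Even.add_one (Even.mul_left ?_ _)
      exact (Nat.even_pow' (by omega)).mpr (by decide)
    · rw [Finset.sum_range_succ, hs]
      have h2 : (2 : ℝ) ^ (tIdx (K + 1))! = 2 ^ (tIdx K)! * 2 ^ ((tIdx (K + 1))! - (tIdx K)!) := by
        rw [← pow_add, Nat.add_sub_cancel' hlt.le]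
      rw [div_add_div _ _ (by positivity) (by positivity), div_eq_div_iff (by positivity)
        (by positivity)]
      push_cast
      rw [h2]
      ring

/-- The tails of `Σ_j 2^{-(t_j)!}` are positive. -/
theorem ellT_tail_pos (K : ℕ) : 0 < ∑' k, 1 / (2 : ℝ) ^ (tIdx (k + K))! :=
  ((summable_nat_add_iff K).mpr summable_ellT).tsum_pos (fun _ => by positivity) 0 (by positivity)

set_option maxHeartbeats 400000 in
/-- Tail bound: `Σ_k 2^{-(t_{k+K})!} ≤ 2 · 2^{-(t_K)!}`. -/
theorem ellT_tail_le (K : ℕ) :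
    ∑' k, 1 / (2 : ℝ) ^ (tIdx (k + K))! ≤ 2 * (1 / (2 : ℝ) ^ (tIdx K)!) := by
  have hg : Summable fun k : ℕ => ((1 : ℝ) / 2) ^ k * (1 / (2 : ℝ) ^ (tIdx K)!) :=
    summable_geometric_two.mul_right _
  have hf : Summable fun k : ℕ => 1 / (2 : ℝ) ^ (tIdx (k + K))! :=
    (summable_nat_add_iff K).mpr summable_ellT
  calc ∑' k, 1 / (2 : ℝ) ^ (tIdx (k + K))!
      ≤ ∑' k : ℕ, ((1 : ℝ) / 2) ^ k * (1 / (2 : ℝ) ^ (tIdx K)!) := by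
        refine Summable.tsum_le_tsum (fun k => ?_) hf hg
        have hle : k + (tIdx K)! ≤ (tIdx (k + K))! := by
          rw [Nat.add_comm k K, Nat.add_comm k]; exact tfact_add_le K k
        rw [one_div_pow, one_div_mul_one_div, ← pow_add]
        exact one_div_pow_le_one_div_pow_of_le (by norm_num) hle
    _ = 2 * (1 / (2 : ℝ) ^ (tIdx K)!) := by rw [tsum_mul_right, tsum_geometric_two]

/-- `ℓ_T` is its `K`-th partial sum plus its tail. -/
theorem ellT_eq_partialSum_add_tail (K : ℕ) :
    ellT = ∑ k ∈ Finset.range K, 1 / (2 : ℝ) ^ (tIdx k)! + ∑' k, 1 / (2 : ℝ) ^ (tIdx (k + K))! :=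
  (summable_ellT.sum_add_tsum_nat_add K).symm

/-- `ℓ_T > 0`. -/
theorem ellT_pos : 0 < ellT := by
  have := ellT_tail_pos 0; simpa [ellT] using this

/-- `ℓ_T < 1`. -/
theorem ellT_lt_one : ellT < 1 := by
  rw [ellT_eq_partialSum_add_tail 1]
  have h := ellT_tail_le 1
  simp only [Finset.sum_range_one, tIdx_zero] at h ⊢
  have e4 : (tIdx 1)! = 24 := by decide
  rw [e4] at h
  norm_num at h ⊢
  linarith

/-- `(t!)^k ≤ (k t)!`. -/
private theorem factorial_pow_le_factorial_mul (t k : ℕ) : (t !) ^ k ≤ (k * t)! := by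
  induction k with
  | zero => simp
  | succ k ih =>
    rw [pow_succ, Nat.succ_mul]
    calc (t !) ^ k * t ! ≤ (k * t)! * t ! := Nat.mul_le_mul_right _ ih
      _ ≤ (k * t + t)! :=
          Nat.le_of_dvd (Nat.factorial_pos _) (Nat.factorial_mul_factorial_dvd_factorial_add _ _)

/-- `t² ≤ 2^t` for `t ≥ 4`. -/
private theorem sq_le_two_pow {t : ℕ} (ht : 4 ≤ t) : t * t ≤ 2 ^ t := by
  induction t, ht using Nat.le_induction with
  | base => norm_num
  | succ t ht ih => rw [pow_succ]; nlinarith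

/-- The key growth inequality of the tower: `2 (t!)^m + 1 ≤ (2^t)!` once `t ≥ max 4 (2(m+1))`. -/
private theorem two_mul_factorial_pow_succ_le {m t : ℕ} (ht4 : 4 ≤ t) (htm : 2 * (m + 1) ≤ t) :
    2 * (t !) ^ m + 1 ≤ (2 ^ t)! := by
  have h1 : (m + 1) * t ≤ 2 ^ t :=
    calc (m + 1) * t ≤ t * t := Nat.mul_le_mul_right t (by omega)
      _ ≤ 2 ^ t := sq_le_two_pow ht4
  have h2 : (t !) ^ (m + 1) ≤ ((m + 1) * t)! := factorial_pow_le_factorial_mul t (m + 1)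
  have h3 : ((m + 1) * t)! ≤ (2 ^ t)! := Nat.factorial_le h1
  have h4 : 3 ≤ t ! := by
    have : 4 ! ≤ t ! := Nat.factorial_le ht4
    have e : 4 ! = 24 := by decide
    omega
  have h5 : 1 ≤ (t !) ^ m := Nat.one_le_pow _ _ (Nat.factorial_pos t)
  calc 2 * (t !) ^ m + 1 ≤ 3 * (t !) ^ m := by omega
    _ ≤ t ! * (t !) ^ m := Nat.mul_le_mul_right _ h4
    _ = (t !) ^ (m + 1) := by ring
    _ ≤ (2 ^ t)! := h2.trans h3

/-- `1/4 < e^{-1}`. -/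
private theorem one_div_four_lt_exp_neg_one : (1 : ℝ) / 4 < Real.exp (-1) := by
  rw [Real.exp_neg, ← one_div]
  exact one_div_lt_one_div_of_lt (Real.exp_pos 1) (by have := Real.exp_one_lt_d9; linarith)

/-- **`ℓ_T` is log-hyper-Liouville.** -/
theorem logHyperLiouville_ellT : LogHyperLiouville ellT := by
  intro m
  set J : ℕ := 2 * (m + 1) + 2 with hJ
  have htJ : 2 * (m + 1) + 4 ≤ tIdx J := by have := le_tIdx J; omega
  obtain ⟨M, hModd, hsum⟩ := ellT_partialSum J
  set a : ℕ := (tIdx J)! with ha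
  set r : ℚ := (M : ℚ) / ((2 : ℚ) ^ a) with hr
  have hden : r.den = 2 ^ a := by
    have hcop : Nat.Coprime (M : ℤ).natAbs ((2 : ℤ) ^ a).natAbs := by
      rw [Int.natAbs_natCast, Int.natAbs_pow]
      exact Nat.Coprime.pow_right a (Nat.coprime_two_right.mpr hModd)
    have h := Rat.den_div_eq_of_coprime (a := (M : ℤ)) (b := (2 : ℤ) ^ a) (by positivity) hcop
    have e : ((M : ℤ) : ℚ) / (((2 : ℤ) ^ a : ℤ) : ℚ) = r := by rw [hr]; push_cast; rfl
    rw [e] at h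
    exact_mod_cast h
  have hrR : (r : ℝ) = ∑ k ∈ Finset.range (J + 1), 1 / (2 : ℝ) ^ (tIdx k)! := by
    rw [hsum, hr]; push_cast; rfl
  set T : ℝ := ∑' k, 1 / (2 : ℝ) ^ (tIdx (k + (J + 1)))! with hT
  have hlam : ellT - r = T := by rw [hrR, ellT_eq_partialSum_add_tail (J + 1)]; ring
  have hTpos : 0 < T := ellT_tail_pos (J + 1)
  have hTle : T ≤ 2 * (1 / (2 : ℝ) ^ (tIdx (J + 1))!) := ellT_tail_le (J + 1)
  refine ⟨r, ?_, ?_, ?_⟩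
  · rw [hden]
    calc m ≤ tIdx J := by omega
      _ ≤ a := Nat.self_le_factorial _
      _ ≤ 2 ^ a := Nat.lt_two_pow_self.le
  · intro h
    have : ellT - r = 0 := by rw [h, sub_self]
    rw [hlam] at this
    exact hTpos.ne' this
  · rw [hlam, abs_of_pos hTpos, hden]
    have hN : 2 * a ^ m + 1 ≤ (tIdx (J + 1))! := by
      rw [tIdx_succ, ha]; exact two_mul_factorial_pow_succ_le (by omega) (by omega)
    have hlog : Real.log ((2 ^ a : ℕ) : ℝ) = a * Real.log 2 := by push_cast; rw [Real.log_pow]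
    have hlog0 : 0 ≤ Real.log ((2 ^ a : ℕ) : ℝ) := by
      rw [hlog]; exact mul_nonneg (Nat.cast_nonneg _) (Real.log_nonneg one_le_two)
    have hlogle : Real.log ((2 ^ a : ℕ) : ℝ) ≤ a := by
      rw [hlog]
      have := Real.log_two_lt_d9
      exact (mul_le_of_le_one_right (Nat.cast_nonneg _) (by linarith))
    have hpow : (Real.log ((2 ^ a : ℕ) : ℝ)) ^ m ≤ (a : ℝ) ^ m := pow_le_pow_left₀ hlog0 hlogle m
    refine lt_of_lt_of_le ?_ (Real.exp_le_exp.mpr (neg_le_neg hpow))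
    have ha1 : a ^ m ≠ 0 := pow_ne_zero _ (Nat.factorial_pos _).ne'
    calc T ≤ 2 * (1 / (2 : ℝ) ^ (tIdx (J + 1))!) := hTle
      _ ≤ 2 * (1 / (2 : ℝ) ^ (2 * a ^ m + 1)) :=
          mul_le_mul_of_nonneg_left (one_div_pow_le_one_div_pow_of_le (by norm_num) hN) (by norm_num)
      _ = ((1 : ℝ) / 4) ^ (a ^ m) := by
          rw [one_div_pow, pow_succ, pow_mul]; norm_num; ring
      _ < (Real.exp (-1)) ^ (a ^ m) := pow_lt_pow_left₀ one_div_four_lt_exp_neg_one (by norm_num) ha1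
      _ = Real.exp (-(a : ℝ) ^ m) := by
          rw [← Real.exp_nat_mul]; push_cast; ring_nf

end Member

end Summit.Schanuel.Schanuel.Theorems.RootDecomp1KRelLiouvilleCell
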